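import Summits.AtomisticToContinuum.Crystallization.Theorems.FrustratedLawDichotomyVirial

/-!
# FrustratedLawDichotomy · crux `AperiodicFrustratedLawGap` (stmt-AtomisticToContinuum-27623) — ZERO PALM STRESS OF MINIMISING LAWS
# (decomp-a2c, prover hand 2, structural share, generation 2)

The first-order content of affine stability.  For `H ∈ End(ℝ³)` and `|t|` small, `A_t = 1 + tH ∈ GL₃(ℝ)` and the floor of item 9229
(hypothesis `hU`) transported along `A_t` (`FrustratedLawDichotomyLinearImages.eStar_le_integral_linearDeformed`) gives
`φ(t) := E_P[Σ_s V_LJ(‖s + tHs‖)] ≥ 2e⋆`, with `φ(0) = 2 E_P[rootEnergy] ≤ 2e⋆` for a minimising law; so `t = 0` is a minimum of `φ` and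
`φ'(0) = 0`.  Differentiating twice under the integral sign (dominated convergence on the configuration, then on the law; the dominating
functions are the shell moments `Σ ‖s‖⁻⁶`, `Σ ‖s‖⁻¹²` of `FrustratedLawDichotomyVirial`):

* `hasDerivAt_pairSum` — for a rooted `δ`-hard-core `μ`: `d/dt Σ_s V_LJ(‖s + tHs‖) = Σ_s (‖v‖⁻⁸ − ‖v‖⁻¹⁴)⟨v, Hs⟩`, `v = s + tHs`, `|t| < ε_H`;
* `hasDerivAt_meanPairSum` — the same under `E_P` at `t = 0`;
* `palmStress_of_minimising` — **ZERO PALM STRESS**: granted the floor, every point-stationary `δ`-hard-core probability law with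
  `E_P[rootEnergy] ≤ e⋆` has `E_P[Σ_s (‖s‖⁻⁸ − ‖s‖⁻¹⁴) ⟨s, H s⟩] = 0` for EVERY `H ∈ End(ℝ³)` — the Palm stress tensor
  `E_P[Σ_s (‖s‖⁻⁸ − ‖s‖⁻¹⁴) s ⊗ s]` vanishes (trace: the virial identity; traceless part: no shear stress).

All `[folklore]` (law-level twin of the zero-stress condition of periodic minimisers).
-/

noncomputable section

namespace Summit.AtomisticToContinuum.Crystallization.Theorems.FrustratedLawDichotomyPalmStress

open MeasureTheory Metric Set Filter
open scoped ENNReal Topology BigOperators RealInnerProductSpace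
open Literature.MathematicalPhysics.StatisticalMechanics Literature.Probability.Process
open Summit.AtomisticToContinuum.Crystallization.Theorems.ChargedEnergyGapNegative (E3 eStar)
open Summit.AtomisticToContinuum.Crystallization.Theorems.FrustratedLawDichotomyLinearImages (eStar_le_integral_linearDeformed)
open Summit.AtomisticToContinuum.Crystallization.Theorems.FrustratedLawDichotomyVirial
  (integrable_invPow integral_invPow_eq_toReal lintegral_invPow_le_of_isRootedHardCore measurable_ofReal_invPow)

/-! ## §1. Calculus of one deformed pair term -/

section PairTerm

variable (H : E3 →L[ℝ] E3)

/-- `V_LJ(r) = Φ(r²)` with `Φ(u) = (1/12) u⁻⁶ − (1/6) u⁻³`. [folklore] -/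
theorem lennardJones_eq_sq (r : ℝ) : lennardJones r = 1 / 12 * (r ^ 2)⁻¹ ^ 6 - 1 / 6 * (r ^ 2)⁻¹ ^ 3 := by
  unfold lennardJones
  rw [← inv_pow, ← pow_mul, ← pow_mul]

/-- For `|t| < 1/(2(‖H‖+1))`: `|t| ‖H‖ ≤ 1/2`. [folklore] -/
theorem abs_mul_norm_le_half {t : ℝ} (ht : |t| < 1 / (2 * (‖H‖ + 1))) : |t| * ‖H‖ ≤ 1 / 2 := by
  have hH : 0 ≤ ‖H‖ := norm_nonneg H
  have h1 : |t| * (‖H‖ + 1) ≤ 1 / 2 := by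
    have := (lt_div_iff₀ (by positivity : (0 : ℝ) < 2 * (‖H‖ + 1))).1 ht
    linarith
  nlinarith [abs_nonneg t]

/-- Two-sided control of the deformed vector: `‖s‖/2 ≤ ‖s + tHs‖ ≤ (3/2)‖s‖` for `|t| ‖H‖ ≤ 1/2`. [folklore] -/
theorem norm_deformed_bounds {t : ℝ} (ht : |t| * ‖H‖ ≤ 1 / 2) (s : E3) :
    ‖s‖ / 2 ≤ ‖s + t • H s‖ ∧ ‖s + t • H s‖ ≤ 3 / 2 * ‖s‖ := by
  have h1 : ‖t • H s‖ ≤ ‖s‖ / 2 := by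
    rw [norm_smul, Real.norm_eq_abs]
    calc |t| * ‖H s‖ ≤ |t| * (‖H‖ * ‖s‖) := mul_le_mul_of_nonneg_left (H.le_opNorm s) (abs_nonneg t)
      _ = |t| * ‖H‖ * ‖s‖ := by ring
      _ ≤ 1 / 2 * ‖s‖ := mul_le_mul_of_nonneg_right ht (norm_nonneg s)
      _ = ‖s‖ / 2 := by ring
  constructor
  · have h2 : ‖s‖ ≤ ‖s + t • H s‖ + ‖t • H s‖ := by
      calc ‖s‖ = ‖(s + t • H s) - t • H s‖ := by rw [add_sub_cancel_right]
        _ ≤ ‖s + t • H s‖ + ‖t • H s‖ := norm_sub_le _ _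
    linarith
  · linarith [norm_add_le s (t • H s)]

/-- **Derivative of one deformed pair term** (`s ≠ 0`... in fact any `s` with `s + tHs ≠ 0`):
`d/dt V_LJ(‖s + tHs‖) = (‖v‖⁻⁸ − ‖v‖⁻¹⁴) ⟨v, Hs⟩`, `v = s + tHs`. [folklore] -/
theorem hasDerivAt_lennardJones_deformed (s : E3) {t : ℝ} (hv : s + t • H s ≠ 0) :
    HasDerivAt (fun t : ℝ => lennardJones ‖s + t • H s‖)
      ((‖s + t • H s‖⁻¹ ^ 8 - ‖s + t • H s‖⁻¹ ^ 14) * ⟪s + t • H s, H s⟫) t := by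
  -- the squared norm is polynomial in `t`
  have hf : HasDerivAt (fun t : ℝ => s + t • H s) (H s) t := by
    simpa using ((hasDerivAt_id t).smul_const (H s)).const_add s
  have hq : HasDerivAt (fun t : ℝ => ‖s + t • H s‖ ^ 2) (2 * ⟪s + t • H s, H s⟫) t := hf.norm_sq
  -- the outer rational function
  set u : ℝ := ‖s + t • H s‖ ^ 2 with hu
  have hu0 : u ≠ 0 := by positivity
  have hinv : HasDerivAt (fun u : ℝ => u⁻¹) (-(u ^ 2)⁻¹) u := hasDerivAt_inv hu0
  have hΦ : HasDerivAt (fun u : ℝ => 1 / 12 * u⁻¹ ^ 6 - 1 / 6 * u⁻¹ ^ 3)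
      (1 / 12 * ((6 : ℕ) * u⁻¹ ^ (6 - 1) * (-(u ^ 2)⁻¹)) - 1 / 6 * ((3 : ℕ) * u⁻¹ ^ (3 - 1) * (-(u ^ 2)⁻¹))) u :=
    ((hinv.fun_pow 6).const_mul (1 / 12)).sub ((hinv.fun_pow 3).const_mul (1 / 6))
  have hcomp := hΦ.comp t hq
  have hfun : (fun t : ℝ => lennardJones ‖s + t • H s‖) = (fun u : ℝ => 1 / 12 * u⁻¹ ^ 6 - 1 / 6 * u⁻¹ ^ 3) ∘ fun t : ℝ => ‖s + t • H s‖ ^ 2 := by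
    funext t'
    simp only [Function.comp_apply, lennardJones_eq_sq]
  rw [hfun]
  refine hcomp.congr_deriv ?_
  -- algebra: `u = ‖v‖²`
  have hu' : u⁻¹ = ‖s + t • H s‖⁻¹ ^ 2 := by rw [hu, inv_pow]
  have hu2 : (u ^ 2)⁻¹ = (‖s + t • H s‖⁻¹ ^ 2) ^ 2 := by rw [← inv_pow, hu']
  rw [hu2, hu']
  push_cast
  ring

/-- **Bounds on the pair term and its derivative** for `|t| ‖H‖ ≤ 1/2`:
`|V_LJ(‖s + tHs‖)| ≤ 2¹² ‖s‖⁻¹² + 2⁶ ‖s‖⁻⁶` and `|(‖v‖⁻⁸ − ‖v‖⁻¹⁴)⟨v, Hs⟩| ≤ ‖H‖ (2¹³ ‖s‖⁻¹² + 2⁷ ‖s‖⁻⁶)`. [folklore] -/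
theorem pairTerm_bounds {t : ℝ} (ht : |t| * ‖H‖ ≤ 1 / 2) (s : E3) :
    |lennardJones ‖s + t • H s‖| ≤ 2 ^ 12 * ‖s‖⁻¹ ^ 12 + 2 ^ 6 * ‖s‖⁻¹ ^ 6 ∧
      |(‖s + t • H s‖⁻¹ ^ 8 - ‖s + t • H s‖⁻¹ ^ 14) * ⟪s + t • H s, H s⟫| ≤ ‖H‖ * (2 ^ 13 * ‖s‖⁻¹ ^ 12 + 2 ^ 7 * ‖s‖⁻¹ ^ 6) := by
  obtain ⟨hlo, hhi⟩ := norm_deformed_bounds H ht s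
  have hH : 0 ≤ ‖H‖ := norm_nonneg H
  by_cases hs : s = 0
  · subst hs
    simp [lennardJones_zero]
  have ha : 0 < ‖s‖ := norm_pos_iff.2 hs
  set a : ℝ := ‖s‖ with ha_def
  set r : ℝ := ‖s + t • H s‖ with hr_def
  have hr : 0 < r := lt_of_lt_of_le (by positivity) hlo
  -- `r⁻¹ ≤ 2 a⁻¹`
  have hinv : r⁻¹ ≤ 2 * a⁻¹ := by
    rw [show 2 * a⁻¹ = (a / 2)⁻¹ by rw [inv_div]; ring]
    exact (inv_le_inv₀ hr (by positivity)).2 hlo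
  have hinv0 : 0 ≤ r⁻¹ := inv_nonneg.2 hr.le
  have hpow : ∀ n : ℕ, r⁻¹ ^ n ≤ 2 ^ n * a⁻¹ ^ n := fun n => by
    rw [← mul_pow]; exact pow_le_pow_left₀ hinv0 hinv n
  have ha0 : 0 ≤ a⁻¹ := inv_nonneg.2 ha.le
  constructor
  · -- the pair term
    rw [abs_le]
    unfold lennardJones
    have h12 := hpow 12
    have h6 := hpow 6
    have h12' : 0 ≤ r⁻¹ ^ 12 := pow_nonneg hinv0 12
    have h6' : 0 ≤ r⁻¹ ^ 6 := pow_nonneg hinv0 6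
    constructor <;> nlinarith
  · -- the derivative
    have hinner : |⟪s + t • H s, H s⟫| ≤ r * (‖H‖ * a) := by
      calc |⟪s + t • H s, H s⟫| ≤ ‖s + t • H s‖ * ‖H s‖ := abs_real_inner_le_norm _ _
        _ ≤ r * (‖H‖ * a) := mul_le_mul_of_nonneg_left (H.le_opNorm s) (norm_nonneg _)
    rw [abs_mul]
    have hfac : |r⁻¹ ^ 8 - r⁻¹ ^ 14| ≤ r⁻¹ ^ 8 + r⁻¹ ^ 14 := by
      have h8 : 0 ≤ r⁻¹ ^ 8 := pow_nonneg hinv0 8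
      have h14 : 0 ≤ r⁻¹ ^ 14 := pow_nonneg hinv0 14
      rw [abs_le]; constructor <;> linarith
    calc |r⁻¹ ^ 8 - r⁻¹ ^ 14| * |⟪s + t • H s, H s⟫|
        ≤ (r⁻¹ ^ 8 + r⁻¹ ^ 14) * (r * (‖H‖ * a)) :=
          mul_le_mul hfac hinner (abs_nonneg _) (by positivity)
      _ = (r⁻¹ ^ 7 + r⁻¹ ^ 13) * (‖H‖ * a) := by
          have hr0 : r ≠ 0 := hr.ne'
          have e8 : r⁻¹ ^ 8 * r = r⁻¹ ^ 7 := by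
            rw [show (8 : ℕ) = 7 + 1 by norm_num, pow_succ, mul_assoc, inv_mul_cancel₀ hr0, mul_one]
          have e14 : r⁻¹ ^ 14 * r = r⁻¹ ^ 13 := by
            rw [show (14 : ℕ) = 13 + 1 by norm_num, pow_succ, mul_assoc, inv_mul_cancel₀ hr0, mul_one]
          calc (r⁻¹ ^ 8 + r⁻¹ ^ 14) * (r * (‖H‖ * a)) = (r⁻¹ ^ 8 * r + r⁻¹ ^ 14 * r) * (‖H‖ * a) := by ring
            _ = (r⁻¹ ^ 7 + r⁻¹ ^ 13) * (‖H‖ * a) := by rw [e8, e14]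
      _ ≤ (2 ^ 7 * a⁻¹ ^ 7 + 2 ^ 13 * a⁻¹ ^ 13) * (‖H‖ * a) :=
          mul_le_mul_of_nonneg_right (add_le_add (hpow 7) (hpow 13)) (by positivity)
      _ = ‖H‖ * (2 ^ 13 * a⁻¹ ^ 12 + 2 ^ 7 * a⁻¹ ^ 6) := by
          have ha' : a ≠ 0 := ha.ne'
          have e7 : a⁻¹ ^ 7 * a = a⁻¹ ^ 6 := by
            rw [show (7 : ℕ) = 6 + 1 by norm_num, pow_succ, mul_assoc, inv_mul_cancel₀ ha', mul_one]
          have e13 : a⁻¹ ^ 13 * a = a⁻¹ ^ 12 := by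
            rw [show (13 : ℕ) = 12 + 1 by norm_num, pow_succ, mul_assoc, inv_mul_cancel₀ ha', mul_one]
          calc (2 ^ 7 * a⁻¹ ^ 7 + 2 ^ 13 * a⁻¹ ^ 13) * (‖H‖ * a)
              = ‖H‖ * (2 ^ 13 * (a⁻¹ ^ 13 * a) + 2 ^ 7 * (a⁻¹ ^ 7 * a)) := by ring
            _ = ‖H‖ * (2 ^ 13 * a⁻¹ ^ 12 + 2 ^ 7 * a⁻¹ ^ 6) := by rw [e7, e13]

/-- Measurability of the pair term and of the derivative term in `s`. [folklore] -/
theorem measurable_pairTerms (t : ℝ) :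
    Measurable (fun s : E3 => lennardJones ‖s + t • H s‖) ∧
      Measurable (fun s : E3 => (‖s + t • H s‖⁻¹ ^ 8 - ‖s + t • H s‖⁻¹ ^ 14) * ⟪s + t • H s, H s⟫) := by
  have hv : Continuous fun s : E3 => s + t • H s := continuous_id.add (H.continuous.const_smul t)
  -- (`Measurable lennardJones` as a local fact: its landed twin lives in a module that is not importable here)
  have hLJ : Measurable lennardJones := by unfold lennardJones; fun_prop
  refine ⟨hLJ.comp hv.norm.measurable, ?_⟩
  exact ((hv.norm.measurable.inv.pow_const 8).sub (hv.norm.measurable.inv.pow_const 14)).mul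
    (hv.inner H.continuous).measurable

/-- **Derivative of the pair term for `|t| ‖H‖ ≤ 1/2` and every `s`** (for `s = 0` the term is constant `0` and the formula reads `0`;
otherwise `‖s + tHs‖ ≥ ‖s‖/2 > 0`). [folklore] -/
theorem hasDerivAt_pairTerm {t : ℝ} (ht : |t| * ‖H‖ ≤ 1 / 2) (s : E3) :
    HasDerivAt (fun t : ℝ => lennardJones ‖s + t • H s‖)
      ((‖s + t • H s‖⁻¹ ^ 8 - ‖s + t • H s‖⁻¹ ^ 14) * ⟪s + t • H s, H s⟫) t := by
  by_cases hs : s = 0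
  · subst hs
    have hfun : (fun t : ℝ => lennardJones ‖(0 : E3) + t • H 0‖) = fun _ => 0 := by
      funext t'; simp [lennardJones_zero]
    rw [hfun]
    simpa using hasDerivAt_const t (0 : ℝ)
  · refine hasDerivAt_lennardJones_deformed H s ?_
    have hlo := (norm_deformed_bounds H ht s).1
    have ha : 0 < ‖s‖ := norm_pos_iff.2 hs
    exact norm_pos_iff.1 (by linarith)

end PairTerm

/-! ## §2. Differentiating the deformed root sum of a hard-core configuration -/

section Config

variable (H : E3 →L[ℝ] E3) {δ : ℝ} {μ : Measure E3}

/-- The dominating functions are integrable against a rooted hard-core configuration (shell moments). [folklore] -/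
theorem integrable_bounds (hδ : 0 < δ) (hμ : IsRootedHardCore δ μ) :
    Integrable (fun s : E3 => 2 ^ 12 * ‖s‖⁻¹ ^ 12 + 2 ^ 6 * ‖s‖⁻¹ ^ 6) μ ∧
      Integrable (fun s : E3 => ‖H‖ * (2 ^ 13 * ‖s‖⁻¹ ^ 12 + 2 ^ 7 * ‖s‖⁻¹ ^ 6)) μ := by
  obtain ⟨h6, h12⟩ := integrable_invPow hδ hμ
  exact ⟨(h12.const_mul _).add (h6.const_mul _), ((h12.const_mul _).add (h6.const_mul _)).const_mul _⟩

/-- Their integrals are bounded by the shell bounds. [folklore] -/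
theorem integral_bounds_le (hδ : 0 < δ) (hμ : IsRootedHardCore δ μ) :
    ∫ s, (2 ^ 12 * ‖s‖⁻¹ ^ 12 + 2 ^ 6 * ‖s‖⁻¹ ^ 6) ∂μ ≤ 2 ^ 12 * (250 * δ⁻¹ ^ 6 * δ⁻¹ ^ 6) + 2 ^ 6 * (250 * δ⁻¹ ^ 6) ∧
      ∫ s, ‖H‖ * (2 ^ 13 * ‖s‖⁻¹ ^ 12 + 2 ^ 7 * ‖s‖⁻¹ ^ 6) ∂μ ≤
        ‖H‖ * (2 ^ 13 * (250 * δ⁻¹ ^ 6 * δ⁻¹ ^ 6) + 2 ^ 7 * (250 * δ⁻¹ ^ 6)) := by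
  obtain ⟨hi6, hi12⟩ := integrable_invPow hδ hμ
  obtain ⟨he6, he12⟩ := integral_invPow_eq_toReal hδ hμ
  obtain ⟨hl6, hl12⟩ := lintegral_invPow_le_of_isRootedHardCore hδ hμ
  have hm6 : ∫ s, ‖s‖⁻¹ ^ 6 ∂μ ≤ 250 * δ⁻¹ ^ 6 := by
    rw [he6, ← ENNReal.toReal_ofReal (by positivity : (0 : ℝ) ≤ 250 * δ⁻¹ ^ 6)]
    exact ENNReal.toReal_mono ENNReal.ofReal_ne_top hl6
  have hm12 : ∫ s, ‖s‖⁻¹ ^ 12 ∂μ ≤ 250 * δ⁻¹ ^ 6 * δ⁻¹ ^ 6 := by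
    rw [he12, ← ENNReal.toReal_ofReal (by positivity : (0 : ℝ) ≤ 250 * δ⁻¹ ^ 6 * δ⁻¹ ^ 6)]
    exact ENNReal.toReal_mono ENNReal.ofReal_ne_top hl12
  have hH : 0 ≤ ‖H‖ := norm_nonneg H
  constructor
  · rw [integral_add (hi12.const_mul _) (hi6.const_mul _), integral_const_mul, integral_const_mul]
    nlinarith
  · rw [integral_const_mul, integral_add (hi12.const_mul _) (hi6.const_mul _), integral_const_mul, integral_const_mul]
    exact mul_le_mul_of_nonneg_left (by nlinarith) hH

/-- The deformed pair term and its derivative are integrable against a rooted hard-core configuration, `|t| ‖H‖ ≤ 1/2`. [folklore] -/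
theorem integrable_pairTerm (hδ : 0 < δ) (hμ : IsRootedHardCore δ μ) {t : ℝ} (ht : |t| * ‖H‖ ≤ 1 / 2) :
    Integrable (fun s : E3 => lennardJones ‖s + t • H s‖) μ ∧
      Integrable (fun s : E3 => (‖s + t • H s‖⁻¹ ^ 8 - ‖s + t • H s‖⁻¹ ^ 14) * ⟪s + t • H s, H s⟫) μ := by
  obtain ⟨hb0, hb1⟩ := integrable_bounds H hδ hμ
  obtain ⟨hm0, hm1⟩ := measurable_pairTerms H t
  refine ⟨hb0.mono' hm0.aestronglyMeasurable (Eventually.of_forall fun s => ?_),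
    hb1.mono' hm1.aestronglyMeasurable (Eventually.of_forall fun s => ?_)⟩
  · rw [Real.norm_eq_abs]; exact (pairTerm_bounds H ht s).1
  · rw [Real.norm_eq_abs]; exact (pairTerm_bounds H ht s).2

/-- The integrals of the pair term and of its derivative are bounded uniformly in the configuration. [folklore] -/
theorem norm_integral_pairTerm_le (hδ : 0 < δ) (hμ : IsRootedHardCore δ μ) {t : ℝ} (ht : |t| * ‖H‖ ≤ 1 / 2) :
    ‖∫ s, lennardJones ‖s + t • H s‖ ∂μ‖ ≤ 2 ^ 12 * (250 * δ⁻¹ ^ 6 * δ⁻¹ ^ 6) + 2 ^ 6 * (250 * δ⁻¹ ^ 6) ∧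
      ‖∫ s, (‖s + t • H s‖⁻¹ ^ 8 - ‖s + t • H s‖⁻¹ ^ 14) * ⟪s + t • H s, H s⟫ ∂μ‖ ≤
        ‖H‖ * (2 ^ 13 * (250 * δ⁻¹ ^ 6 * δ⁻¹ ^ 6) + 2 ^ 7 * (250 * δ⁻¹ ^ 6)) := by
  obtain ⟨hb0, hb1⟩ := integrable_bounds H hδ hμ
  obtain ⟨hB0, hB1⟩ := integral_bounds_le H hδ hμ
  refine ⟨(norm_integral_le_of_norm_le hb0 (Eventually.of_forall fun s => ?_)).trans hB0,
    (norm_integral_le_of_norm_le hb1 (Eventually.of_forall fun s => ?_)).trans hB1⟩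
  · rw [Real.norm_eq_abs]; exact (pairTerm_bounds H ht s).1
  · rw [Real.norm_eq_abs]; exact (pairTerm_bounds H ht s).2

/-- For `|t| < ε_H = 1/(2(‖H‖+1))`: membership in the ball and `|t| ‖H‖ ≤ 1/2`. [folklore] -/
theorem abs_mul_norm_le_half_of_mem_ball {t : ℝ} (ht : t ∈ ball (0 : ℝ) (1 / (2 * (‖H‖ + 1)))) : |t| * ‖H‖ ≤ 1 / 2 := by
  rw [mem_ball, Real.dist_eq, sub_zero] at ht
  exact abs_mul_norm_le_half H ht

/-- **Differentiating the deformed root sum of a hard-core configuration under the sum** (dominated convergence, dominating function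
`‖H‖(2¹³ ‖s‖⁻¹² + 2⁷ ‖s‖⁻⁶)`): for `|t₀| < ε_H`,
`d/dt|_{t₀} Σ_s V_LJ(‖s + tHs‖) = Σ_s (‖v‖⁻⁸ − ‖v‖⁻¹⁴)⟨v, Hs⟩`, `v = s + t₀Hs`. [folklore] -/
theorem hasDerivAt_pairSum (hδ : 0 < δ) (hμ : IsRootedHardCore δ μ) {t₀ : ℝ} (ht₀ : t₀ ∈ ball (0 : ℝ) (1 / (2 * (‖H‖ + 1)))) :
    HasDerivAt (fun t : ℝ => ∫ s, lennardJones ‖s + t • H s‖ ∂μ)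
      (∫ s, (‖s + t₀ • H s‖⁻¹ ^ 8 - ‖s + t₀ • H s‖⁻¹ ^ 14) * ⟪s + t₀ • H s, H s⟫ ∂μ) t₀ := by
  have hball : ball (0 : ℝ) (1 / (2 * (‖H‖ + 1))) ∈ 𝓝 t₀ := isOpen_ball.mem_nhds ht₀
  obtain ⟨_, hb1⟩ := integrable_bounds H hδ hμ
  have key := hasDerivAt_integral_of_dominated_loc_of_deriv_le (μ := μ) (x₀ := t₀)
    (F := fun (t : ℝ) (s : E3) => lennardJones ‖s + t • H s‖)
    (F' := fun (t : ℝ) (s : E3) => (‖s + t • H s‖⁻¹ ^ 8 - ‖s + t • H s‖⁻¹ ^ 14) * ⟪s + t • H s, H s⟫)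
    (bound := fun s : E3 => ‖H‖ * (2 ^ 13 * ‖s‖⁻¹ ^ 12 + 2 ^ 7 * ‖s‖⁻¹ ^ 6)) hball
    (Eventually.of_forall fun t => (measurable_pairTerms H t).1.aestronglyMeasurable)
    (integrable_pairTerm H hδ hμ (abs_mul_norm_le_half_of_mem_ball H ht₀)).1
    (measurable_pairTerms H t₀).2.aestronglyMeasurable
    (Eventually.of_forall fun s t ht => by
      rw [Real.norm_eq_abs]; exact (pairTerm_bounds H (abs_mul_norm_le_half_of_mem_ball H ht) s).2)
    hb1
    (Eventually.of_forall fun s t ht => hasDerivAt_pairTerm H (abs_mul_norm_le_half_of_mem_ball H ht) s)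
  exact key.2

end Config

/-! ## §3. Differentiating the mean deformed root sum of a law -/

section Law

variable (H : E3 →L[ℝ] E3) {δ : ℝ} {P : Measure (Measure E3)}

/-- `μ ↦ ∫ f dμ` is a.e.-strongly measurable under a law almost surely carried by configurations against which `f` is integrable
(it agrees a.e. with the difference of the measurable `±`-part integrals). [folklore] -/
theorem aestronglyMeasurable_integral {f : E3 → ℝ} (hf : Measurable f) (h : ∀ᵐ μ ∂P, Integrable f μ) :
    AEStronglyMeasurable (fun μ : Measure E3 => ∫ s, f s ∂μ) P := by
  refine ⟨fun μ => (∫⁻ s, ENNReal.ofReal (f s) ∂μ).toReal - (∫⁻ s, ENNReal.ofReal (-f s) ∂μ).toReal, ?_, ?_⟩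
  · exact ((Measure.measurable_lintegral (ENNReal.measurable_ofReal.comp hf)).ennreal_toReal.sub
      (Measure.measurable_lintegral (ENNReal.measurable_ofReal.comp hf.neg)).ennreal_toReal).stronglyMeasurable
  · exact h.mono fun μ hμ => integral_eq_lintegral_pos_part_sub_lintegral_neg_part hμ

/-- **Differentiating the MEAN deformed root sum under the law** (dominated convergence once more, constant dominating function): for a
finite law almost surely carried by rooted `δ`-hard-core configurations,
`d/dt|₀ E_P[Σ_s V_LJ(‖s + tHs‖)] = E_P[Σ_s (‖s‖⁻⁸ − ‖s‖⁻¹⁴)⟨s, Hs⟩]`. [folklore] -/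
theorem hasDerivAt_meanPairSum (hδ : 0 < δ) [IsFiniteMeasure P] (hcore : ∀ᵐ μ ∂P, IsRootedHardCore δ μ) :
    HasDerivAt (fun t : ℝ => ∫ μ, ∫ s, lennardJones ‖s + t • H s‖ ∂μ ∂P)
      (∫ μ, ∫ s, (‖s‖⁻¹ ^ 8 - ‖s‖⁻¹ ^ 14) * ⟪s, H s⟫ ∂μ ∂P) 0 := by
  have hε0 : 0 < 1 / (2 * (‖H‖ + 1)) := by positivity
  have hball : ball (0 : ℝ) (1 / (2 * (‖H‖ + 1))) ∈ 𝓝 (0 : ℝ) := ball_mem_nhds 0 hε0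
  have h0mem : (0 : ℝ) ∈ ball (0 : ℝ) (1 / (2 * (‖H‖ + 1))) := mem_ball_self hε0
  have hF_meas : ∀ᶠ t in 𝓝 (0 : ℝ), AEStronglyMeasurable (fun μ : Measure E3 => ∫ s, lennardJones ‖s + t • H s‖ ∂μ) P :=
    Filter.eventually_of_mem hball fun t ht => aestronglyMeasurable_integral (measurable_pairTerms H t).1
      (hcore.mono fun μ hμ => (integrable_pairTerm H hδ hμ (abs_mul_norm_le_half_of_mem_ball H ht)).1)
  have hF_int : Integrable (fun μ : Measure E3 => ∫ s, lennardJones ‖s + (0 : ℝ) • H s‖ ∂μ) P :=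
    Integrable.of_bound hF_meas.self_of_nhds _ (hcore.mono fun μ hμ =>
      (norm_integral_pairTerm_le H hδ hμ (abs_mul_norm_le_half_of_mem_ball H h0mem)).1)
  have hF'_meas : AEStronglyMeasurable
      (fun μ : Measure E3 => ∫ s, (‖s + (0 : ℝ) • H s‖⁻¹ ^ 8 - ‖s + (0 : ℝ) • H s‖⁻¹ ^ 14) * ⟪s + (0 : ℝ) • H s, H s⟫ ∂μ) P :=
    aestronglyMeasurable_integral (measurable_pairTerms H 0).2
      (hcore.mono fun μ hμ => (integrable_pairTerm H hδ hμ (abs_mul_norm_le_half_of_mem_ball H h0mem)).2)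
  have key := hasDerivAt_integral_of_dominated_loc_of_deriv_le (μ := P) (x₀ := (0 : ℝ))
    (F := fun (t : ℝ) (μ : Measure E3) => ∫ s, lennardJones ‖s + t • H s‖ ∂μ)
    (F' := fun (t : ℝ) (μ : Measure E3) => ∫ s, (‖s + t • H s‖⁻¹ ^ 8 - ‖s + t • H s‖⁻¹ ^ 14) * ⟪s + t • H s, H s⟫ ∂μ)
    (bound := fun _ : Measure E3 => ‖H‖ * (2 ^ 13 * (250 * δ⁻¹ ^ 6 * δ⁻¹ ^ 6) + 2 ^ 7 * (250 * δ⁻¹ ^ 6))) hball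
    hF_meas hF_int hF'_meas
    (hcore.mono fun μ hμ t ht => (norm_integral_pairTerm_le H hδ hμ (abs_mul_norm_le_half_of_mem_ball H ht)).2)
    (integrable_const _)
    (hcore.mono fun μ hμ t ht => hasDerivAt_pairSum H hδ hμ ht)
  have h := key.2
  simp only [zero_smul, add_zero] at h
  exact h

end Law

/-! ## §4. Zero Palm stress of minimising laws -/

section Stress

variable {δ : ℝ} {P : Measure (Measure E3)}

/-- **ZERO PALM STRESS OF MINIMISING LAWS.**  Granted the energy floor for point-stationary hard-core probability laws (item 9229, hypothesis
`hU`), every point-stationary `δ`-hard-core probability law `P` with `E_P[rootEnergy] ≤ e⋆` satisfies, for EVERY `H ∈ End(ℝ³)`,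
`E_P[Σ_s (‖s‖⁻⁸ − ‖s‖⁻¹⁴) ⟨s, H s⟩] = 0`: the Palm stress tensor `E_P[Σ_s (‖s‖⁻⁸ − ‖s‖⁻¹⁴) s ⊗ s]` vanishes.  Proof: `1 + tH ∈ GL₃(ℝ)` for
`|t| < ε_H`, so the transported floor gives `φ(t) = E_P[Σ_s V_LJ(‖s + tHs‖)] ≥ 2e⋆ = φ(0)`; Fermat and `hasDerivAt_meanPairSum`. [folklore] -/
theorem palmStress_of_minimising
    (hU : ∀ δ' : ℝ, 0 < δ' → ∀ Q : Measure (Measure E3), IsProbabilityMeasure Q → (∀ᵐ μ ∂Q, IsRootedHardCore δ' μ) →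
      IsPointStationaryLaw Q → eStar ≤ ∫ μ, rootEnergy lennardJones μ ∂Q)
    (hδ : 0 < δ) [IsProbabilityMeasure P] (hcore : ∀ᵐ μ ∂P, IsRootedHardCore δ μ) (hstat : IsPointStationaryLaw P)
    (hmin : ∫ μ, rootEnergy lennardJones μ ∂P ≤ eStar) (H : E3 →L[ℝ] E3) :
    ∫ μ, ∫ s, (‖s‖⁻¹ ^ 8 - ‖s‖⁻¹ ^ 14) * ⟪s, H s⟫ ∂μ ∂P = 0 := by
  have hε0 : 0 < 1 / (2 * (‖H‖ + 1)) := by positivity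
  have hball : ball (0 : ℝ) (1 / (2 * (‖H‖ + 1))) ∈ 𝓝 (0 : ℝ) := ball_mem_nhds 0 hε0
  set φ : ℝ → ℝ := fun t => ∫ μ, ∫ s, lennardJones ‖s + t • H s‖ ∂μ ∂P with hφ
  -- the floor transported along `1 + tH ∈ GL₃(ℝ)`
  have hfloor : ∀ t ∈ ball (0 : ℝ) (1 / (2 * (‖H‖ + 1))), 2 * eStar ≤ φ t := by
    intro t ht
    have ht' := abs_mul_norm_le_half_of_mem_ball H ht
    set L : E3 →ₗ[ℝ] E3 := LinearMap.id + t • (H : E3 →ₗ[ℝ] E3) with hL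
    have hLapply : ∀ s, L s = s + t • H s := fun s => by simp [hL]
    have hLinj : Function.Injective L := by
      intro x y hxy
      by_contra hne
      have hpos : 0 < ‖x - y‖ := norm_pos_iff.2 (sub_ne_zero.2 hne)
      have hlo := (norm_deformed_bounds H ht' (x - y)).1
      have h0 : L (x - y) = 0 := by rw [map_sub, hxy, sub_self]
      rw [hLapply] at h0
      rw [h0, norm_zero] at hlo
      linarith
    set A : E3 ≃L[ℝ] E3 := (LinearEquiv.ofInjectiveEndo L hLinj).toContinuousLinearEquiv with hA
    have hAapply : ∀ s, A s = s + t • H s := fun s => by simp [hA, hL]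
    have h := eStar_le_integral_linearDeformed hU hδ hcore hstat A
    simp only [hAapply] at h
    rw [integral_div] at h
    have : (∫ μ, ∫ y, lennardJones ‖y + t • H y‖ ∂μ ∂P) = φ t := rfl
    linarith
  -- the undeformed value
  have hφ0 : φ 0 = 2 * ∫ μ, rootEnergy lennardJones μ ∂P := by
    simp only [hφ, zero_smul, add_zero]
    rw [← integral_const_mul]
    refine integral_congr_ae (Eventually.of_forall fun μ => ?_)
    simp only [rootEnergy_def]
    ring
  -- Fermat
  have hlocmin : IsLocalMin φ 0 :=
    Filter.eventually_of_mem hball fun t ht => by rw [hφ0]; linarith [hfloor t ht]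
  exact hlocmin.hasDerivAt_eq_zero (hasDerivAt_meanPairSum H hδ hcore)

/-- **Trace check: the virial identity again.**  With `H = 1` the stress identity reads `E_P[Σ_s (‖s‖⁻⁶ − ‖s‖⁻¹²)] = 0` pointwise
(`(‖s‖⁻⁸ − ‖s‖⁻¹⁴)‖s‖² = ‖s‖⁻⁶ − ‖s‖⁻¹²`, also at `s = 0`). [folklore] -/
theorem stress_trace_integrand (s : E3) :
    (‖s‖⁻¹ ^ 8 - ‖s‖⁻¹ ^ 14) * ⟪s, (1 : E3 →L[ℝ] E3) s⟫ = ‖s‖⁻¹ ^ 6 - ‖s‖⁻¹ ^ 12 := by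
  change (‖s‖⁻¹ ^ 8 - ‖s‖⁻¹ ^ 14) * ⟪s, s⟫ = _
  rw [real_inner_self_eq_norm_sq]
  by_cases hs : s = 0
  · subst hs; simp
  · have ha : ‖s‖ ≠ 0 := norm_ne_zero_iff.2 hs
    have e8 : ‖s‖⁻¹ ^ 8 * ‖s‖ ^ 2 = ‖s‖⁻¹ ^ 6 := by
      rw [show (8 : ℕ) = 6 + 2 by norm_num, pow_add, mul_assoc, ← mul_pow, inv_mul_cancel₀ ha, one_pow, mul_one]
    have e14 : ‖s‖⁻¹ ^ 14 * ‖s‖ ^ 2 = ‖s‖⁻¹ ^ 12 := by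
      rw [show (14 : ℕ) = 12 + 2 by norm_num, pow_add, mul_assoc, ← mul_pow, inv_mul_cancel₀ ha, one_pow, mul_one]
    rw [sub_mul, e8, e14]

end Stress

end Summit.AtomisticToContinuum.Crystallization.Theorems.FrustratedLawDichotomyPalmStress

end
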